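import Mathlib.Geometry.Manifold.Instances.Sphere
import Mathlib.Geometry.Manifold.Diffeomorph
import Mathlib.Geometry.Manifold.MFDeriv.Defs
import Mathlib.Geometry.Manifold.PoincareConjecture
import Mathlib.Analysis.Quaternion
import Mathlib.Topology.Homotopy.Equiv
import HarnessLib

/-!
# Free smooth `S³`-actions on `S⁷`: definitions and named facts

Topic `Literature/Topology/FourManifolds` (orbit spaces of such actions are exactly the smooth
homotopy 4-spheres realised over the standard `S⁷`). Staged by the soloist seat
`solo-SmoothPoincare4-blind` (ideation tier, 2026-08-18); informal companion:
`run/shared/lean/ideation/SmoothPoincare4/solo-blind/paper/total-space-reformulations.md`.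
What is reproduced here — DEFINITIONS plus four textbook NAMED FACTS (nothing asserted):

* `FreeS3ActionS7` — a free `C^∞` left action of the unit-quaternion group `S³ ⊂ ℍ` on the standard
  7-sphere `S⁷ ⊂ ℝ⁸` (both with Mathlib's stereographic analytic structure); `IsConj` — smooth
  conjugacy of two such actions by a self-diffeomorphism of `S⁷`; `IsOrbitMap` — "`π : S⁷ → M`
  presents the smooth 4-manifold `M` as the orbit space" (smooth surjective submersion whose fibres
  are exactly the orbits; the submersion clause pins down the quotient smooth structure).
* Named facts, each used as an explicit hypothesis `(h : X)`:
  - `ExistsOrbitSpaceOfFreeS3ActionS7` — every free smooth `S³`-action on `S⁷` has a smooth orbit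
    space (quotient manifold theorem, Lee 2012 Thm. 21.10; Gleason's lemma), Hausdorff and second
    countable, which is a homotopy 4-sphere (long exact sequence of the fibration `S³ → S⁷ → M`:
    `π₁ = π₂ = π₃ = 0`, `M` a closed 4-manifold; Hatcher 2002 Thm. 4.41).
  - `OrbitSpaceDiffeomorphOfIsConj` — conjugate actions have diffeomorphic orbit spaces
    (smooth maps descend through surjective submersions; Lee 2012 Thms. 4.29–4.31).
  - `ExistsHopfActionS7` — the Hopf action (left quaternionic multiplication on `S⁷ ⊂ ℍ²`) is a
    free smooth action with orbit space the standard `S⁴` (Hatcher 2002 Example 4.46; Steenrod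
    1951 §20).
  - `IsConjOfOrbitSpacesSphere` — two free smooth `S³`-actions on `S⁷` whose orbit spaces are both
    diffeomorphic to the standard `S⁴` are conjugate (principal `SU(2)`-bundles over `S⁴` are
    classified by `π₃(S³) ≅ ℤ`, Husemoller Ch. 8 Cor. 8.4 / Steenrod 1951 §18; total space `S⁷`
    forces the class `±1` by the
    Gysin sequence, and the two signs are exchanged by pulling back along a reflection of `S⁴`, which
    is covered by an equivariant diffeomorphism of total spaces).

Context (not stated here, problem-side): free `S³`-actions on homotopy `(4n+3)`-spheres versus
smoothings of `ℍPⁿ` is Basu–Kasilingam 2022 §4 (Lemma 4.3, Remark 4.4, for orbit spaces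
PL-homeomorphic to `ℍPⁿ`); the statement that EVERY smooth homotopy 4-sphere (exotic or not) is the
orbit space of a free smooth `S³`-action on the standard `S⁷`, and the resulting equivalence of the
smooth 4-dimensional Poincaré conjecture with "any two free smooth `S³`-actions on `S⁷` are
conjugate", are the seat's claims and live under `Summits/SmoothPoincare4`.

Design choices. Actions are unbundled functions with explicit axioms rather than Mathlib
`MulAction` + `LieGroup` instances: Mathlib has no Lie-group structure on `S³ ⊂ ℍ` and no smooth
quotients / fibre bundles, so orbit spaces are described relationally by `IsOrbitMap`. The
manifold structure on `Metric.sphere (0 : ℍ) 1` is Mathlib's `EuclideanSpace.instChartedSpaceSphere`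
under the `Fact (finrank ℝ ℍ = 3 + 1)` recorded below (same device as Mathlib's `Circle`).
Deliberately NOT here: principal bundles, characteristic classes, the Eells–Kuiper invariant.

## References

* N. Steenrod, *The Topology of Fibre Bundles*, Princeton Math. Series 14 (1951), §18
  (classification of bundles over spheres), §20 (the Hopf fiberings).
* J. M. Lee, *Introduction to Smooth Manifolds*, 2nd ed., GTM 218 (2012), Thms. 4.29–4.31
  (passing to the quotient through surjective submersions), Thm. 21.10 (quotient manifold theorem).
* A. Hatcher, *Algebraic Topology* (2002), §4.2: Thm. 4.41 (long exact sequence of a fibre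
  bundle), Example 4.46 (the quaternionic Hopf bundles `S³ → S⁴ⁿ⁺³ → ℍPⁿ`).
* D. Husemoller, *Fibre Bundles*, 3rd ed., GTM 20 (1994), Ch. 8 §8, Cor. 8.4 (principal
  `G`-bundles over `Sⁿ` are classified by `π_{n-1}(G)` for path-connected `G`).
* S. Basu, R. Kasilingam, *Inertia groups and smooth structures on quaternionic projective
  spaces*, Forum Math. 34 (2022), doi:10.1515/forum-2020-0125 (arXiv:1708.06582), §4 (context only).
-/

noncomputable section

open scoped Manifold ContDiff Quaternion
open Metric (sphere)

namespace Literature.Topology.FourManifolds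

/-- Local notation: `𝔼 n` is the model Euclidean space `EuclideanSpace ℝ (Fin n)`. -/
local notation "𝔼 " n:arg => EuclideanSpace ℝ (Fin n)

/-- Local notation: `𝕊 n` is the unit sphere in `EuclideanSpace ℝ (Fin (n + 1))`. -/
local notation "𝕊 " n:arg => (Metric.sphere (0 : EuclideanSpace ℝ (Fin (n + 1))) 1)

/-- The real quaternions have dimension `3 + 1`; recorded as a `Fact` so that Mathlib's
stereographic charted-space and analytic-manifold instances apply to the unit sphere
`Metric.sphere (0 : ℍ) 1 = S³` (cf. Mathlib's `finrank_real_complex_fact'` for `Circle`).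
Activate with `attribute [local instance] fact_finrank_real_quaternion`. [folklore] -/
theorem fact_finrank_real_quaternion : Fact (Module.finrank ℝ ℍ = 3 + 1) :=
  ⟨by rw [Quaternion.finrank_eq_four]⟩

attribute [local instance] fact_finrank_real_quaternion

/-- The group `S³` of unit quaternions, `Metric.sphere (0 : ℍ) 1`, with Mathlib's group structure
(`Metric.unitSphere.instGroup`) and — under `fact_finrank_real_quaternion` — its structure of an
analytic 3-manifold modelled on `𝓡 3`. [folklore] -/
abbrev UnitQuaternions : Type := sphere (0 : ℍ) 1

/-- A **free smooth left action of `S³` (unit quaternions) on the standard 7-sphere**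
`S⁷ = Metric.sphere (0 : EuclideanSpace ℝ (Fin 8)) 1`: a jointly `C^∞` map
`S³ × S⁷ → S⁷` satisfying the action axioms, with every stabiliser trivial.
Equivalently (Gleason; Lee 2012 Thm. 21.10) a smooth principal `SU(2)`-bundle structure on `S⁷`
over the orbit space. [folklore] -/
structure FreeS3ActionS7 where
  /-- The action map `(q, x) ↦ q • x`. -/
  act : UnitQuaternions → 𝕊 7 → 𝕊 7
  /-- Joint smoothness of `(q, x) ↦ q • x` as a map of manifolds `S³ × S⁷ → S⁷`. -/
  contMDiff_act : ContMDiff ((𝓡 3).prod (𝓡 7)) (𝓡 7) ∞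
    (fun p : UnitQuaternions × 𝕊 7 => act p.1 p.2)
  /-- The identity acts trivially. -/
  one_act : ∀ x, act 1 x = x
  /-- Compatibility with the group law: `(p * q) • x = p • (q • x)`. -/
  mul_act : ∀ p q x, act (p * q) x = act p (act q x)
  /-- Freeness: only the identity has a fixed point. -/
  free : ∀ q x, act q x = x → q = 1

namespace FreeS3ActionS7

/-- Two free smooth `S³`-actions `a`, `b` on `S⁷` are **conjugate** (smoothly equivalent): there is
a self-diffeomorphism `φ` of `S⁷` with `φ (q •ₐ x) = q •_b (φ x)` for all `q`, `x` (strict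
equivariance, no automorphism of `S³`). [folklore] -/
def IsConj (a b : FreeS3ActionS7) : Prop :=
  ∃ φ : 𝕊 7 ≃ₘ⟮𝓡 7, 𝓡 7⟯ 𝕊 7, ∀ q x, φ (a.act q x) = b.act q (φ x)

/-- `π : S⁷ → M` **presents the smooth 4-manifold `M` as the orbit space** of the free action `a`:
`π` is `C^∞`, surjective, a submersion (every `mfderiv` surjective — this clause makes the smooth
structure of `M` the quotient one, Lee 2012 Thm. 4.31), and its fibres are exactly the `a`-orbits.
[folklore] -/
def IsOrbitMap (a : FreeS3ActionS7) (M : Type*) [TopologicalSpace M] [ChartedSpace (𝔼 4) M]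
    (π : 𝕊 7 → M) : Prop :=
  ContMDiff (𝓡 7) (𝓡 4) ∞ π ∧ Function.Surjective π ∧
    (∀ x, Function.Surjective (mfderiv (𝓡 7) (𝓡 4) π x)) ∧
    ∀ x y, π x = π y ↔ ∃ q, a.act q x = y

end FreeS3ActionS7

/-- NAMED FACT (**quotient manifold theorem + homotopy type of the orbit space**; Lee 2012
Thm. 21.10; Hatcher 2002 Thm. 4.41): every free smooth `S³`-action on `S⁷` has an orbit space which
is a Hausdorff second-countable smooth 4-manifold presented by an orbit map, and that orbit space is
homotopy equivalent to `S⁴` (`π₁ = π₂ = π₃ = 0` from the exact sequence of `S³ → S⁷ → M`, `M` a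
closed simply connected 4-manifold with `H₂ = 0`). Users take `(h : ExistsOrbitSpaceOfFreeS3ActionS7)`.
[cite: Lee2012, Thm. 21.10 (quotient manifold theorem); homotopy type: Hatcher 2002 Thm. 4.41] -/
def ExistsOrbitSpaceOfFreeS3ActionS7 : Prop :=
  ∀ a : FreeS3ActionS7,
    ∃ (M : Type) (_ : TopologicalSpace M) (_ : T2Space M) (_ : SecondCountableTopology M)
      (_ : ChartedSpace (𝔼 4) M) (_ : IsManifold (𝓡 4) ∞ M) (π : 𝕊 7 → M),
      a.IsOrbitMap M π ∧ Nonempty (ContinuousMap.HomotopyEquiv M (𝕊 4))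

/-- NAMED FACT (**smooth maps descend through surjective submersions**; Lee 2012 Thms. 4.29–4.31):
if `φ` conjugates `a` to `b` and `πa : S⁷ → M`, `πb : S⁷ → N` are orbit maps, then `πb ∘ φ` is
constant on `a`-orbits and descends to a diffeomorphism `M ≃ N` (its inverse descends from
`πa ∘ φ⁻¹`). Users take `(h : OrbitSpaceDiffeomorphOfIsConj)`.
[cite: Lee2012, Ch. 4, Thms. 4.29–4.31 (surjective submersions are quotient maps in the smooth category)] -/
def OrbitSpaceDiffeomorphOfIsConj : Prop :=
  ∀ (a b : FreeS3ActionS7) (M N : Type) [TopologicalSpace M] [ChartedSpace (𝔼 4) M]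
    [IsManifold (𝓡 4) ∞ M] [TopologicalSpace N] [ChartedSpace (𝔼 4) N] [IsManifold (𝓡 4) ∞ N]
    (πa : 𝕊 7 → M) (πb : 𝕊 7 → N),
    a.IsOrbitMap M πa → b.IsOrbitMap N πb → a.IsConj b → Nonempty (M ≃ₘ⟮𝓡 4, 𝓡 4⟯ N)

/-- NAMED FACT (**the quaternionic Hopf fibration**; Hatcher 2002 Example 4.46, Steenrod 1951
§20): left multiplication by unit quaternions on `S⁷ ⊂ ℍ² ≅ ℝ⁸` is a free smooth
`S³`-action whose orbit space is the standard `S⁴`, presented by the Hopf map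
`(u, v) ↦ (2 ū v, |u|² − |v|²) ∈ S⁴ ⊂ ℍ ⊕ ℝ`. Users take `(h : ExistsHopfActionS7)`.
[cite: Hatcher2002, §4.2 Example 4.46 (the Hopf bundle S³ → S⁷ → S⁴ = ℍP¹)] -/
def ExistsHopfActionS7 : Prop :=
  ∃ (a : FreeS3ActionS7) (π : 𝕊 7 → 𝕊 4), a.IsOrbitMap (𝕊 4) π

/-- NAMED FACT (**classification of principal `SU(2)`-bundles over `S⁴`**; Husemoller, *Fibre
Bundles*, Ch. 8 Cor. 8.4; Steenrod 1951 §18):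
two free smooth `S³`-actions on `S⁷` whose orbit spaces are both diffeomorphic to the standard
`S⁴` are conjugate. (Such bundles are classified by `π₃(S³) ≅ ℤ`; total space `S⁷` forces the
class `±1`; the two signs differ by the pull-back along a reflection of `S⁴`, which is covered by an
equivariant diffeomorphism of total spaces; a bundle isomorphism over the identity is an equivariant
diffeomorphism.) Users take `(h : IsConjOfOrbitSpacesSphere)`.
[cite: HusemollerFibreBundles1994, Ch. 8 §8, Cor. 8.4 (principal G-bundles over Sⁿ ↔ π_{n-1}(G))] -/
def IsConjOfOrbitSpacesSphere : Prop :=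
  ∀ (a b : FreeS3ActionS7) (M N : Type) [TopologicalSpace M] [ChartedSpace (𝔼 4) M]
    [IsManifold (𝓡 4) ∞ M] [TopologicalSpace N] [ChartedSpace (𝔼 4) N] [IsManifold (𝓡 4) ∞ N]
    (πa : 𝕊 7 → M) (πb : 𝕊 7 → N),
    a.IsOrbitMap M πa → b.IsOrbitMap N πb →
      Nonempty (M ≃ₘ⟮𝓡 4, 𝓡 4⟯ 𝕊 4) → Nonempty (N ≃ₘ⟮𝓡 4, 𝓡 4⟯ 𝕊 4) → a.IsConj b

end Literature.Topology.FourManifolds
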